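import Summits.BirchSwinnertonDyer.BirchSwinnertonDyer.Theorems.ErratumRoadFiveAuxPrimeTraceCandidates
import Literature.NumberTheory.EllipticCurves.HeegnerPointsKolyvaginCebotarevProofs
import Literature.NumberTheory.GaloisRepresentations.ImaginaryQuadraticCyclotomicProofs
import Literature.NumberTheory.GaloisRepresentations.ArtinFormalismInductionProofs
import Mathlib.LinearAlgebra.Trace
import HarnessLib

/-!
# The Frobenius witness of the aux-norm line from `ρ̄_{E,p}` onto and `p ≥ 5` (group theory in `Γ_ℚ`)

Helper file for crux `stmt-BirchSwinnertonDyer-19715`, line `aux_norm_receptacle`, stub S3♭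
`stub_auxiliaryPrimeSupply` — step (F3a-2) of F1–F4 (seat bsd-line-er5-p1-w2 g5). Theorems only;
nothing here closes 19715.

* `exists_preWitness` — for `W/ℚ` with `ρ̄_{E,p} : Γ_ℚ → Aut(E[p])` ONTO, `p ≥ 5`, `K` imaginary
  quadratic and `ζ` a primitive `p^E`-th root of unity (`E ≥ 1`), there is `γ ∈ Γ_ℚ` with
  (i) `γ ∉ res Γ_K`, (ii) `γ ζ = ζ⁻¹`, (iii) `tr ρ̄_{E,p}(γ) ≠ 0`.  Construction: `γ = c₀ d` with
  `c₀` a complex conjugation (`χ_{p^E}(c₀) = -1`, `c₀ ∉ res Γ_K` as `K` is totally complex) and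
  `d ∈ {1, d₁, d₂, d₁d₂}`, `dᵢ = xᵢ yᵢ xᵢ⁻¹ yᵢ⁻¹` commutators of lifts of `diag(2, 2⁻¹)`, `shearX 3⁻¹`
  (resp. `diag(2⁻¹,2)`, `shearY 3⁻¹`) — a commutator lies in the index-2 subgroup `res Γ_K` and in
  `ker χ_{p^E}`, and acts on `E[p]` as `shearX 1` (resp. `shearY 1`); one of the four traces is
  non-zero (`exists_trace_comp_ne_zero`).  No Weil pairing and no Serre lifting are used.
* `exists_witness_of_kummerExclusion` — the coset lemma: given `γ₀` with (i)–(iii) and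
  `α^p = e β`, if NO `p`-th root of `e β / γ₀(e β)` is fixed by
  `H₁ = res Γ_K ∩ ker χ_{p^E} ∩ ker ρ̄_{E,p}` (the Kummer exclusion), then some `γ = γ₀ a`, `a ∈ H₁`,
  also has (iv) `γ² α ≠ α`: for `a ∈ H₁`, `(γ₀a)²α = ω₁ω₂⁻¹ · γ₀²α` with `aα = ω₁α`,
  `a(γ₀α) = ω₂(γ₀α)` (`γ₀` inverts and `a` fixes `μ_p`), so if every `(γ₀a)²α = α` then
  `ω₁ = ω₂`, i.e. `a` fixes `α/γ₀α` — for all `a ∈ H₁`.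
Together with `exists_auxPrime_of_frobeniusWitness` (F2) this leaves, for S3♭, only the Kummer
exclusion for `β` a generator of `𝔮^{ord [𝔮]}` (F3b).

References: B. H. Gross, LMS LNS 153 (1991), §9 [GrossLMS1991]; J.-P. Serre, Invent. Math. 15
(1972), §2 [Serre1972].
-/

noncomputable section

set_option linter.dupNamespace false -- `Summit.BirchSwinnertonDyer.BirchSwinnertonDyer` (summit = problem), tree-wide

open scoped Classical NumberField
open WeierstrassCurve NumberField Field
open Literature.NumberTheory.GaloisRepresentations Literature.NumberTheory.EllipticCurves
open Literature.NumberTheory.EllipticCurves.KolyvaginImage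

namespace Summit.BirchSwinnertonDyer.BirchSwinnertonDyer.Theorems.AuxPrimeSupply

/-! ### Cyclotomic character bookkeeping -/

/-- If `χ_{p^E}(σ) = -1` then `σ` acts by inversion on every `p^E`-th root of unity. [folklore] -/
theorem smul_eq_inv_of_cyclotomicCharacter_eq_neg_one {p : ℕ} [Fact p.Prime] {E : ℕ}
    [NeZero (p ^ E)] {σ : absoluteGaloisGroup ℚ}
    (hσ : (modNCyclotomicCharacter ℚ (p ^ E) σ : ZMod (p ^ E)) = -1)
    {t : AlgebraicClosure ℚ} (ht : t ^ (p ^ E) = 1) : σ • t = t⁻¹ := by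
  have hspec := modNCyclotomicCharacter_spec ℚ (p ^ E) σ t ht
  rw [hσ] at hspec
  have hmul : σ • t * t = 1 := by
    rw [hspec, ← pow_succ]
    have hdvd : p ^ E ∣ (-1 : ZMod (p ^ E)).val + 1 := by
      apply (ZMod.natCast_eq_zero_iff _ _).mp
      push_cast
      rw [ZMod.natCast_zmod_val, neg_add_cancel]
    obtain ⟨k, hk⟩ := hdvd
    rw [hk, pow_mul, ht, one_pow]
  exact eq_inv_of_mul_eq_one_left hmul

/-- If `χ_{p^E}(σ) = 1` then `σ` fixes every `p^E`-th root of unity. [folklore] -/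
theorem smul_eq_self_of_cyclotomicCharacter_eq_one {p : ℕ} [Fact p.Prime] {E : ℕ}
    [NeZero (p ^ E)] (hE : 1 ≤ E) {σ : absoluteGaloisGroup ℚ}
    (hσ : modNCyclotomicCharacter ℚ (p ^ E) σ = 1)
    {t : AlgebraicClosure ℚ} (ht : t ^ (p ^ E) = 1) : σ • t = t := by
  have hp : p.Prime := Fact.out
  haveI : Fact (1 < p ^ E) := ⟨Nat.one_lt_pow (by omega) hp.one_lt⟩
  have hspec := modNCyclotomicCharacter_spec ℚ (p ^ E) σ t ht
  rw [hσ, Units.val_one, ZMod.val_one, pow_one] at hspec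
  exact hspec

/-- `σ • ζ = ζ⁻¹` for a primitive `p^E`-th root `ζ` iff-direction used here: it forces
`χ_{p^E}(σ) = -1`. [folklore] -/
theorem cyclotomicCharacter_eq_neg_one_of_smul_eq_inv {p : ℕ} [Fact p.Prime] {E : ℕ}
    [NeZero (p ^ E)] {σ : absoluteGaloisGroup ℚ} {ζ : AlgebraicClosure ℚ}
    (hζ : IsPrimitiveRoot ζ (p ^ E)) (h : σ • ζ = ζ⁻¹) :
    (modNCyclotomicCharacter ℚ (p ^ E) σ : ZMod (p ^ E)) = -1 := by
  have hpos : 0 < p ^ E := Nat.pos_of_ne_zero (NeZero.ne _)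
  have h' : σ • ζ = ζ ^ (p ^ E - 1) := by
    rw [h]
    have : ζ ^ (p ^ E - 1) * ζ = 1 := by rw [← pow_succ, Nat.sub_add_cancel hpos, hζ.pow_eq_one]
    exact (eq_inv_of_mul_eq_one_left this).symm
  rw [modNCyclotomicCharacter_eq_of_smul_eq_pow ℚ (p ^ E) hζ σ h']
  have : ((p ^ E - 1 : ℕ) : ZMod (p ^ E)) + 1 = 0 := by
    have h1 : ((p ^ E - 1 + 1 : ℕ) : ZMod (p ^ E)) = 0 := by
      rw [Nat.sub_add_cancel hpos, ZMod.natCast_self]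
    exact_mod_cast h1
  exact eq_neg_of_add_eq_zero_left this

/-- `σ • ζ = ζ` for a primitive `p^E`-th root forces `χ_{p^E}(σ) = 1`. [folklore] -/
theorem cyclotomicCharacter_eq_one_of_smul_eq {p : ℕ} [Fact p.Prime] {E : ℕ}
    [NeZero (p ^ E)] {σ : absoluteGaloisGroup ℚ} {ζ : AlgebraicClosure ℚ}
    (hζ : IsPrimitiveRoot ζ (p ^ E)) (h : σ • ζ = ζ) :
    modNCyclotomicCharacter ℚ (p ^ E) σ = 1 := by
  ext
  rw [Units.val_one, ← Nat.cast_one]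
  exact modNCyclotomicCharacter_eq_of_smul_eq_pow ℚ (p ^ E) hζ σ (by rw [pow_one]; exact h)

/-! ### Commutators of `Γ_ℚ`: in `res Γ_K`, in `ker χ`, acting as the commutator of the actions -/

/-- A commutator `x y x⁻¹ y⁻¹` of `Γ_ℚ` lies in the index-`2` subgroup `res Γ_K` (`K` quadratic) and
fixes a primitive `p^E`-th root of unity `ζ` (`χ_{p^E}` takes values in an abelian group). [folklore] -/
theorem commutator_mem_range_and_smul_eq {K : Type} [Field K] [NumberField K]
    (hK2 : Module.finrank ℚ K = 2) {p : ℕ} [Fact p.Prime] {E : ℕ} [NeZero (p ^ E)] (hE : 1 ≤ E)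
    {ζ : AlgebraicClosure ℚ} (hζ : IsPrimitiveRoot ζ (p ^ E)) (x y : absoluteGaloisGroup ℚ) :
    x * y * x⁻¹ * y⁻¹ ∈ (absGaloisRestrict ℚ K).range ∧ (x * y * x⁻¹ * y⁻¹) • ζ = ζ := by
  haveI : FiniteDimensional ℚ K := Module.finite_of_finrank_eq_succ hK2
  have hHi : ((absGaloisRestrict ℚ K).range).index = 2 :=
    (index_range_absGaloisRestrict_eq_finrank ℚ K).trans hK2
  refine ⟨?_, ?_⟩
  · simp only [Subgroup.mul_mem_iff_of_index_two hHi, inv_mem_iff]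
    tauto
  · apply smul_eq_self_of_cyclotomicCharacter_eq_one hE _ hζ.pow_eq_one
    rw [map_mul, map_mul, map_mul, map_inv, map_inv, mul_comm (modNCyclotomicCharacter ℚ (p ^ E) x),
      mul_inv_cancel_right, mul_inv_cancel]

/-- If `x, y ∈ Γ_ℚ` act on `E[p]` as the additive automorphisms `A, B`, then `x y x⁻¹ y⁻¹` acts as
`A ∘ B ∘ A⁻¹ ∘ B⁻¹`. [folklore] -/
theorem commutator_smul_eq {F : Type*} [Field F] (W : WeierstrassCurve F) {n : ℤ}
    {A B : geomTorsion W n ≃+ geomTorsion W n} {x y : absoluteGaloisGroup F}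
    (hx : ∀ P, x • P = A P) (hy : ∀ P, y • P = B P) (P : geomTorsion W n) :
    (x * y * x⁻¹ * y⁻¹) • P = A (B (A.symm (B.symm P))) := by
  have hx' : ∀ Q, x⁻¹ • Q = A.symm Q := fun Q ↦ by
    rw [eq_comm, AddEquiv.symm_apply_eq, ← hx, smul_inv_smul]
  have hy' : ∀ Q, y⁻¹ • Q = B.symm Q := fun Q ↦ by
    rw [eq_comm, AddEquiv.symm_apply_eq, ← hy, smul_inv_smul]
  rw [mul_smul, mul_smul, mul_smul, hy', hx', hy, hx]

/-! ### The pre-witness: (i), (ii), (iii) -/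

/-- **A Frobenius witness for (i)–(iii)** from `ρ̄_{E,p}` onto, `p ≥ 5`, `K` imaginary quadratic:
some `γ ∈ Γ_ℚ` has `γ ∉ res Γ_K`, `γ • ζ = ζ⁻¹` (`ζ` primitive of order `p^E`, `E ≥ 1`) and
non-zero trace on `E[p]`.  `γ = c₀ d`, `c₀` a complex conjugation, `d` a product of at most two
commutators of lifts of `diag(2, 2⁻¹)`, `shearX 3⁻¹` / `diag(2⁻¹, 2)`, `shearY 3⁻¹`
(`exists_trace_comp_ne_zero`, `exists_shearX_one_eq_comm`). [cite: GrossLMS1991, §9 (Prop. 9.1: 𝒢 ≅ GL₂(ℤ/p))] -/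
theorem exists_preWitness (W : WeierstrassCurve ℚ) [W.IsElliptic] {K : Type} [Field K]
    [NumberField K] (hK : IsImaginaryQuadratic K) {p : ℕ} [Fact p.Prime] (hp5 : 5 ≤ p)
    (hsurj : W.HasSurjectiveModNGaloisRep p) {E : ℕ} (hE : 1 ≤ E)
    {ζ : AlgebraicClosure ℚ} (hζ : IsPrimitiveRoot ζ (p ^ E)) :
    ∃ γ : absoluteGaloisGroup ℚ, γ ∉ (absGaloisRestrict ℚ K).range ∧ γ • ζ = ζ⁻¹ ∧
      letI : Module (ZMod p) (geomTorsion W p) := AddSubgroup.torsionBy.zmodModule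
      LinearMap.trace (ZMod p) (geomTorsion W p)
        ((galoisRepTorsion W p γ).toAdd.toAddMonoidHom.toZModLinearMap p) ≠ 0 := by
  letI : Module (ZMod p) (geomTorsion W p) := AddSubgroup.torsionBy.zmodModule
  have hp : p.Prime := Fact.out
  haveI : NeZero (p ^ E) := ⟨pow_ne_zero E hp.ne_zero⟩
  haveI : Algebra.IsQuadraticExtension ℚ K := ⟨hK.1⟩
  set H := (absGaloisRestrict ℚ K).range with hH
  -- complex conjugation
  obtain ⟨c₀, hc₀⟩ := exists_isComplexConjugation (Rat.castHom ℝ)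
  have hc₀H : c₀ ∉ H := Rat.not_mem_range_absGaloisRestrict_of_isComplexConjugation K hK.2 hc₀
  have hc₀ζ : c₀ • ζ = ζ⁻¹ :=
    smul_eq_inv_of_cyclotomicCharacter_eq_neg_one
      (modNCyclotomicCharacter_of_isComplexConjugation (K := ℚ) (N := p ^ E) hc₀) hζ.pow_eq_one
  -- the frame of `E[p]`
  have hT : ∀ P : geomTorsion W p, p • P = 0 := fun P ↦ by
    apply Subtype.ext
    rw [AddSubgroupClass.coe_nsmul, ← natCast_zsmul]
    exact P.2
  have hcard : Nat.card (geomTorsion W p) = p ^ 2 :=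
    card_torsionPoints_eq_sq_holds W (AlgebraicClosure ℚ) (by exact_mod_cast hp.ne_zero)
  obtain ⟨e⟩ := nonempty_addEquiv_of_card_eq_sq hT hcard
  -- lifting additive automorphisms of `E[p]` to `Γ_ℚ`
  have lift : ∀ A : geomTorsion W p ≃+ geomTorsion W p,
      ∃ x : absoluteGaloisGroup ℚ, ∀ P, x • P = A P := fun A ↦ by
    obtain ⟨x, hx⟩ := hsurj (Multiplicative.ofAdd A)
    exact ⟨x, fun P ↦ by rw [← galoisRepTorsion_apply, hx, toAdd_ofAdd]⟩
  -- the two commutators acting as `shearX 1`, `shearY 1`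
  have htsymm : ∀ (B : (Fin 2 → ZMod p) ≃+ (Fin 2 → ZMod p)) (P : geomTorsion W p),
      (transport e B).symm P = e.symm (B.symm (e P)) := fun B P ↦ rfl
  obtain ⟨D₁, S₁, hDS₁⟩ := exists_shearX_one_eq_comm (p := p) hp5
  obtain ⟨D₂, S₂, hDS₂⟩ := exists_shearY_one_eq_comm (p := p) hp5
  obtain ⟨x₁, hx₁⟩ := lift (transport e D₁)
  obtain ⟨y₁, hy₁⟩ := lift (transport e S₁)
  obtain ⟨x₂, hx₂⟩ := lift (transport e D₂)
  obtain ⟨y₂, hy₂⟩ := lift (transport e S₂)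
  set d₁ := x₁ * y₁ * x₁⁻¹ * y₁⁻¹ with hd₁
  set d₂ := x₂ * y₂ * x₂⁻¹ * y₂⁻¹ with hd₂
  have hd₁P : ∀ P, d₁ • P = transport e (shearX 1) P := fun P ↦ by
    rw [hd₁, commutator_smul_eq W hx₁ hy₁, transport_apply, transport_apply, htsymm, htsymm,
      transport_apply, e.apply_symm_apply, e.apply_symm_apply, e.apply_symm_apply, ← hDS₁]
  have hd₂P : ∀ P, d₂ • P = transport e (shearY 1) P := fun P ↦ by
    rw [hd₂, commutator_smul_eq W hx₂ hy₂, transport_apply, transport_apply, htsymm, htsymm,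
      transport_apply, e.apply_symm_apply, e.apply_symm_apply, e.apply_symm_apply, ← hDS₂]
  obtain ⟨hd₁H, hd₁ζ⟩ := commutator_mem_range_and_smul_eq hK.1 hE hζ x₁ y₁
  obtain ⟨hd₂H, hd₂ζ⟩ := commutator_mem_range_and_smul_eq hK.1 hE hζ x₂ y₂
  rw [← hd₁] at hd₁H hd₁ζ
  rw [← hd₂] at hd₂H hd₂ζ
  -- `γ = c₀ d` with `d ∈ H` fixing `ζ` has (i) and (ii)
  have key : ∀ d ∈ H, d • ζ = ζ → c₀ * d ∉ H ∧ (c₀ * d) • ζ = ζ⁻¹ := fun d hdH hdζ ↦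
    ⟨fun h ↦ hc₀H (by simpa using H.mul_mem h (H.inv_mem hdH)), by rw [mul_smul, hdζ, hc₀ζ]⟩
  -- the four traces
  set M : geomTorsion W p →+ geomTorsion W p := (galoisRepTorsion W p c₀).toAdd.toAddMonoidHom
    with hM
  have hMinj : Function.Injective M := (galoisRepTorsion W p c₀).toAdd.injective
  have hMP : ∀ P, M P = c₀ • P := fun P ↦ rfl
  have hρ : ∀ (γ : absoluteGaloisGroup ℚ) (f : geomTorsion W p →+ geomTorsion W p),
      (∀ P, γ • P = f P) → (galoisRepTorsion W p γ).toAdd.toAddMonoidHom = f := fun γ f h ↦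
    AddMonoidHom.ext fun P ↦ h P
  rcases exists_trace_comp_ne_zero e M hMinj with h | h | h | h
  · exact ⟨c₀, hc₀H, hc₀ζ, h⟩
  · obtain ⟨h1, h2⟩ := key d₁ hd₁H hd₁ζ
    refine ⟨c₀ * d₁, h1, h2, ?_⟩
    rwa [hρ (c₀ * d₁) (M.comp (transport e (shearX 1)).toAddMonoidHom) (fun P ↦ by
      rw [mul_smul, hd₁P, AddMonoidHom.coe_comp, Function.comp_apply, hMP]; rfl)]
  · obtain ⟨h1, h2⟩ := key d₂ hd₂H hd₂ζ
    refine ⟨c₀ * d₂, h1, h2, ?_⟩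
    rwa [hρ (c₀ * d₂) (M.comp (transport e (shearY 1)).toAddMonoidHom) (fun P ↦ by
      rw [mul_smul, hd₂P, AddMonoidHom.coe_comp, Function.comp_apply, hMP]; rfl)]
  · obtain ⟨h1, h2⟩ := key (d₁ * d₂) (H.mul_mem hd₁H hd₂H) (by rw [mul_smul, hd₂ζ, hd₁ζ])
    refine ⟨c₀ * (d₁ * d₂), h1, h2, ?_⟩
    rwa [hρ (c₀ * (d₁ * d₂)) (M.comp ((transport e (shearX 1)).toAddMonoidHom.comp
        (transport e (shearY 1)).toAddMonoidHom)) (fun P ↦ by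
      rw [mul_smul, mul_smul, hd₂P, hd₁P, AddMonoidHom.coe_comp, Function.comp_apply, hMP,
        AddMonoidHom.coe_comp, Function.comp_apply]; rfl)]

/-! ### The coset lemma: (iv) from the Kummer exclusion -/

/-- **The coset lemma.** Let `γ₀ ∈ Γ_ℚ` satisfy (i) `γ₀ ∉ res Γ_K`, (ii) `γ₀ • ζ = ζ⁻¹`,
(iii) `tr ρ̄_{E,p}(γ₀) ≠ 0`, and let `α^p = e β ≠ 0`.  Suppose the KUMMER EXCLUSION: no `p`-th root
`y` of `e β / γ₀(e β)` is fixed by all of `H₁ = res Γ_K ∩ Stab(ζ) ∩ ker ρ̄_{E,p}`.  Then some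
`γ = γ₀ a` (`a ∈ H₁`) satisfies (i)–(iii) and (iv) `γ² α ≠ α`.  Proof: (i)–(iii) are stable under
`γ₀ ↦ γ₀ a`; if (iv) failed for every such `γ`, then with `a α = ω₁ α`, `a (γ₀α) = ω₂ (γ₀α)`
(`ωᵢ^p = 1`; `γ₀` inverts and `a` fixes `μ_p ⊆ μ_{p^E}`) one computes
`(γ₀a)²α = ω₁ ω₂⁻¹ γ₀²α = ω₁ ω₂⁻¹ α`, so `ω₁ = ω₂`, i.e. `a` fixes `y = α / γ₀α` — for the `a`
supplied by the exclusion, a contradiction. [cite: GrossLMS1991, §9 (proof of Prop. 9.5: choice of Frobenius in a coset)] -/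
theorem exists_witness_of_kummerExclusion (W : WeierstrassCurve ℚ) [W.IsElliptic] {K : Type}
    [Field K] [NumberField K] (hK : IsImaginaryQuadratic K) {p : ℕ} [Fact p.Prime] {E : ℕ}
    (hE : 1 ≤ E) (e : K →ₐ[ℚ] AlgebraicClosure ℚ) {β : 𝓞 K} {ζ α : AlgebraicClosure ℚ}
    (hζ : IsPrimitiveRoot ζ (p ^ E)) (hα : α ^ p = e (β : K)) (hα0 : α ≠ 0)
    {γ₀ : absoluteGaloisGroup ℚ} (h1 : γ₀ ∉ (absGaloisRestrict ℚ K).range) (h2 : γ₀ • ζ = ζ⁻¹)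
    (h3 : letI : Module (ZMod p) (geomTorsion W p) := AddSubgroup.torsionBy.zmodModule
      LinearMap.trace (ZMod p) (geomTorsion W p)
        ((galoisRepTorsion W p γ₀).toAdd.toAddMonoidHom.toZModLinearMap p) ≠ 0)
    (hKum : ∀ y : AlgebraicClosure ℚ, y ^ p = e (β : K) * (γ₀ • e (β : K))⁻¹ →
      ∃ a : absoluteGaloisGroup ℚ, a ∈ (absGaloisRestrict ℚ K).range ∧ a • ζ = ζ ∧
        galoisRepTorsion W p a = 1 ∧ a • y ≠ y) :
    ∃ γ : absoluteGaloisGroup ℚ, γ ∉ (absGaloisRestrict ℚ K).range ∧ γ • ζ = ζ⁻¹ ∧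
      (letI : Module (ZMod p) (geomTorsion W p) := AddSubgroup.torsionBy.zmodModule
      LinearMap.trace (ZMod p) (geomTorsion W p)
        ((galoisRepTorsion W p γ).toAdd.toAddMonoidHom.toZModLinearMap p) ≠ 0) ∧
      (γ * γ) • α ≠ α := by
  letI : Module (ZMod p) (geomTorsion W p) := AddSubgroup.torsionBy.zmodModule
  have hp : p.Prime := Fact.out
  haveI : NeZero (p ^ E) := ⟨pow_ne_zero E hp.ne_zero⟩
  haveI : Algebra.IsQuadraticExtension ℚ K := ⟨hK.1⟩
  set H := (absGaloisRestrict ℚ K).range with hH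
  have hHi : H.index = 2 := (index_range_absGaloisRestrict_eq_finrank ℚ K).trans hK.1
  haveI hHn : H.Normal := Subgroup.normal_of_index_eq_two hHi
  have hχ₀ : (modNCyclotomicCharacter ℚ (p ^ E) γ₀ : ZMod (p ^ E)) = -1 :=
    cyclotomicCharacter_eq_neg_one_of_smul_eq_inv hζ h2
  have hpow : ∀ ω : AlgebraicClosure ℚ, ω ^ p = 1 → ω ^ (p ^ E) = 1 := fun ω h ↦ by
    obtain ⟨k, hk⟩ : p ∣ p ^ E := dvd_pow_self p (by omega)
    rw [hk, pow_mul, h, one_pow]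
  have heβ0 : e (β : K) ≠ 0 := by rw [← hα]; exact pow_ne_zero p hα0
  by_contra hcon
  have hcon' : ∀ γ : absoluteGaloisGroup ℚ, γ ∉ H → γ • ζ = ζ⁻¹ →
      LinearMap.trace (ZMod p) (geomTorsion W p)
        ((galoisRepTorsion W p γ).toAdd.toAddMonoidHom.toZModLinearMap p) ≠ 0 →
      (γ * γ) • α = α := by
    intro γ ha hb hc
    by_contra h
    exact hcon ⟨γ, ha, hb, hc, h⟩
  have h00 : (γ₀ * γ₀) • α = α := hcon' γ₀ h1 h2 h3
  set α' := γ₀ • α with hα'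
  have hα'0 : α' ≠ 0 := by rw [hα', Ne, smul_eq_zero_iff_eq]; exact hα0
  have hα'p : α' ^ p = γ₀ • e (β : K) := by rw [hα', ← smul_pow', hα]
  have hγα' : γ₀ • α' = α := by rw [hα', ← mul_smul]; exact h00
  -- the `p`-th root `y = α / γ₀α` of `e β / γ₀(e β)` and the element `a` of the exclusion
  set y := α * α'⁻¹ with hy
  have hyp : y ^ p = e (β : K) * (γ₀ • e (β : K))⁻¹ := by rw [hy, mul_pow, inv_pow, hα, hα'p]
  obtain ⟨a, haH, haζ, haρ, hay⟩ := hKum y hyp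
  have hχa : modNCyclotomicCharacter ℚ (p ^ E) a = 1 := cyclotomicCharacter_eq_one_of_smul_eq hζ haζ
  -- `γ₀ a` has (i)–(iii), hence `((γ₀a)(γ₀a)) • α = α`
  have hi : γ₀ * a ∉ H := fun h ↦ h1 (by simpa using H.mul_mem h (H.inv_mem haH))
  have hii : (γ₀ * a) • ζ = ζ⁻¹ := by rw [mul_smul, haζ, h2]
  have hiii : LinearMap.trace (ZMod p) (geomTorsion W p)
      ((galoisRepTorsion W p (γ₀ * a)).toAdd.toAddMonoidHom.toZModLinearMap p) ≠ 0 := by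
    rw [map_mul, haρ, mul_one]; exact h3
  have hT := hcon' (γ₀ * a) hi hii hiii
  -- `a` fixes `e β` and `γ₀ • e β`
  have haβ : a • e (β : K) = e (β : K) := by
    obtain ⟨g, hg⟩ := haH
    rw [← hg]
    exact absGaloisRestrict_smul_apply_eq g e (β : K)
  have haβ' : a • (γ₀ • e (β : K)) = γ₀ • e (β : K) := by
    obtain ⟨g', hg'⟩ := hHn.conj_mem' a haH γ₀
    have hfix : (γ₀⁻¹ * a * γ₀) • e (β : K) = e (β : K) := by
      rw [← hg']
      exact absGaloisRestrict_smul_apply_eq g' e (β : K)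
    calc a • (γ₀ • e (β : K)) = γ₀ • ((γ₀⁻¹ * a * γ₀) • e (β : K)) := by
          rw [mul_smul, mul_smul, smul_inv_smul]
      _ = γ₀ • e (β : K) := by rw [hfix]
  -- the roots of unity `ω₁ = aα/α`, `ω₂ = aα'/α'`
  set ω₁ := a • α * α⁻¹ with hω₁
  set ω₂ := a • α' * α'⁻¹ with hω₂
  have hω₁α : a • α = ω₁ * α := by rw [hω₁, inv_mul_cancel_right₀ hα0]
  have hω₂α : a • α' = ω₂ * α' := by rw [hω₂, inv_mul_cancel_right₀ hα'0]
  have hω₁p : ω₁ ^ p = 1 := by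
    rw [hω₁, mul_pow, inv_pow, ← smul_pow', hα, haβ, mul_inv_cancel₀ heβ0]
  have hω₂p : ω₂ ^ p = 1 := by
    have h0 : γ₀ • e (β : K) ≠ 0 := by rw [Ne, smul_eq_zero_iff_eq]; exact heβ0
    rw [hω₂, mul_pow, inv_pow, ← smul_pow', hα'p, haβ', mul_inv_cancel₀ h0]
  have hγω₁ : γ₀ • ω₁ = ω₁⁻¹ := smul_eq_inv_of_cyclotomicCharacter_eq_neg_one hχ₀ (hpow ω₁ hω₁p)
  have hγω₂ : γ₀ • ω₂ = ω₂⁻¹ := smul_eq_inv_of_cyclotomicCharacter_eq_neg_one hχ₀ (hpow ω₂ hω₂p)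
  have haω₁ : a • ω₁ = ω₁ := smul_eq_self_of_cyclotomicCharacter_eq_one hE hχa (hpow ω₁ hω₁p)
  -- `((γ₀a)(γ₀a)) • α = ω₁ ω₂⁻¹ α`
  have hcalc : ((γ₀ * a) * (γ₀ * a)) • α = ω₁ * ω₂⁻¹ * α := by
    rw [mul_smul, mul_smul, mul_smul, hω₁α, smul_mul', hγω₁, ← hα', smul_mul', smul_inv'', haω₁,
      hω₂α, smul_mul', smul_mul', smul_inv'', hγω₁, inv_inv, hγω₂, hγα']
    ring
  rw [hcalc, mul_eq_right₀ hα0] at hT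
  have hω : ω₁ = ω₂ := by
    have hω₂0 : ω₂ ≠ 0 := fun h ↦ by rw [h, zero_pow hp.ne_zero] at hω₂p; exact zero_ne_one hω₂p
    rwa [mul_inv_eq_one₀ hω₂0] at hT
  apply hay
  rw [hy, smul_mul', smul_inv'', hω₁α, hω₂α, hω, mul_inv, mul_mul_mul_comm, mul_inv_cancel₀
    (fun h ↦ by rw [h, zero_pow hp.ne_zero] at hω₂p; exact zero_ne_one hω₂p), one_mul]

end Summit.BirchSwinnertonDyer.BirchSwinnertonDyer.Theorems.AuxPrimeSupply

end
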